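import Summits.CriticalPhenomena.PercolationContinuityZ3.Theorems.Transplant.KNCells2ChainBand
import HarnessLib

/-!
# Corridor chains of route D″ v2 — the LOCALISATION ROUNDS (Kozma–Nitzan's Lemma 12′, P4-GENERAL §16.4 (U3′a), DPRIME-SCOPE §2 L6′ (C) "NEW":
# the two-phase shrink that precedes the straight band run): a planar schedule of SYMMETRIC cores `{|level| ≤ L_i, |trans| ≤ W_i}` about a centre
# `c`, shrinking along ONE axis `a` by `ℓ₁ − R'` per round down to the least certified extent `ℓ₀`, each walker travelling TOWARDS the centre
# line (its own sign picks the direction `σ`), the band rectangle `v + [−ℓ, ℓ] × [−Wb ℓ, Wb ℓ]` as route and the SIDE-HALF towards the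
# transverse centre line as target (non-expansion `W_{i+1} = max (W_i + R') WM`) — pure `Site 2` geometry, companion of p1-g9's `KNCells2ChainBand`

builds on p205010 (kernel theorem, internal audit signed; external expert review pending) — nothing in this file uses p205010.
Lane `prim-bschramm`, seat `prim-bschramm-p5` (gen 6; (C) column of the D″ order of battle incl. the Lemma 12′ localisation, DPRIME §5 / K.4);
helper file (`--supports stmt-CriticalPhenomena-4575 --as helper`).

WHY (refuter's checklist DP7): under `(ℤ/2)²` a side-half only PREVENTS growth of the transverse coordinate; CONTRACTION of a coordinate is obtained by
travelling along it with the directed side on the near line — the direction depends on the walker, so the cores must be symmetric sets and the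
direction `σ` sits inside the `∃` of the route lemma (the `roomR`/`core_route` pattern), never in the record.  The node of record's `ChainPlanar.Sched`
does the same with square quarter-pieces (10 rounds along, 11 across, then 65 advance steps); here the route is the band rectangle of p1-g9's
`route_band_advance` and the extent is chosen per walker in the certified range `[ℓ₀, ℓ₁]`: `ℓ = ℓ₁` far out, `ℓ = |level|` in between (landing ON
the centre line), `ℓ = ℓ₀` near the line (overshoot `< ℓ₀`).  Applied twice (axis `a`, then `oth a` with the roles of `L`, `W` exchanged) it takes a
walker set of size `3r_a × 3r_{a'}` (the cube `M`) into the start box of the band run; room: `L₀ + R' + ℓ₁ ≤ 5 r_a` (⟸ `A ≥ 2` for `L₀ = 3r_a`,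
`ℓ₁ ≤ 3e_a`) and `W₀ + N R' + WM ≤ 5 r_{a'}` (⟸ (X)/(U4′)).
* §1 **`route_loc`** — one round from a walker `v` with `|level(v)| ≤ L + R'`, `|trans(v)| ≤ W + R'`: `∃ ℓ ∈ [ℓ₀, ℓ₁], ∃ σ = ±1`, the band rectangle
  about `v` inside `sBox a 1 c (−(L + R' + ℓ₁)) (L + R' + ℓ₁) (W + R' + WM)`, and `∃ τ = ±1` with the `τ`-half of the `σ`-side inside the next core
  `sBox a 1 c (−L⁺) L⁺ (max (W + R') WM)`, `L⁺ := max (L + R' − ℓ₁) ℓ₀`;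
* §2 the schedule `Loc.L L₀ R' ℓ₀ ℓ₁ i`, `Loc.W W₀ R' WM i`, `Loc.core`, `Loc.region` (ONE region for all rounds), `Loc.LocOK`, **`Loc.core_route`**,
  `Loc.enlarge_core_subset_region`, `Loc.core_succ_subset_region`, `Loc.core_nonempty`, `Loc.L_le_of_le` / **`Loc.L_eq_ℓ₀`** (after
  `N ≥ (L₀ + R') / (ℓ₁ − R')`… rounds the along-width is `ℓ₀`), `Loc.W_eq` (`W i = W₀ + i R'` once `WM ≤ W₀`).
[cite: KozmaNitzan2024, §4 Lemma 12 (pp. 23–25: the rounds into the target box), Lemma 11 (pp. 22–23)]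
-/

noncomputable section

namespace Summit.CriticalPhenomena.PercolationContinuityZ3.Theorems

namespace Transplant

namespace ChainPlanar

open Literature.Probability.Percolation Literature.Probability.LatticeModels
open Literature.Probability.Percolation.KozmaNitzan
open Literature.Probability.Percolation.KozmaNitzan.Cells (oth oth_ne eq_oth_of_ne)

/-! ## §1 One localisation round -/

/-- **BAND ROUTE FOR A LOCALISATION ROUND.**  Centre `c`, axis `a`; current along-width `L`, transverse width `W`; neighbourhood radius `R'`;
certified extents `[ℓ₀, ℓ₁]` with `R' ≤ ℓ₁`; transverse band width `Wb ≤ WM` on `[0, ℓ₁]`.  For every walker `v` with `|v_a − c_a| ≤ L + R'`,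
`|v_{a'} − c_{a'}| ≤ W + R'` there are an extent `ℓ ∈ [ℓ₀, ℓ₁]` and a direction `σ` such that every `y` with `|y_a − v_a| ≤ ℓ`,
`|y_{a'} − v_{a'}| ≤ Wb ℓ` lies in the region `{|·_a − c_a| ≤ L + R' + ℓ₁, |·_{a'} − c_{a'}| ≤ W + R' + WM}`, and a half-sign `τ` such that every `y` on
the `σ`-side of the rectangle (`y_a − v_a = σ ℓ`) in the `τ`-half (`0 ≤ τ (y_{a'} − v_{a'})`, `|y_{a'} − v_{a'}| ≤ Wb ℓ`) lies in the shrunk core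
`{|·_a − c_a| ≤ max (L + R' − ℓ₁) ℓ₀, |·_{a'} − c_{a'}| ≤ max (W + R') WM}`. [cite: KozmaNitzan2024, §4 Lemma 12 (pp. 23–25)] -/
theorem route_loc {a : Fin 2} (c : Site 2) {L W : ℤ} {R' ℓ₀ ℓ₁ WM : ℕ} (Wb : ℕ → ℕ) (hℓ : ℓ₀ ≤ ℓ₁)
    (hWM : ∀ ℓ : ℕ, ℓ ≤ ℓ₁ → Wb ℓ ≤ WM) {v : Site 2} (hv : v ∈ sBox a 1 c (-(L + R')) (L + R') (W + R')) :
    ∃ ℓ : ℕ, ℓ₀ ≤ ℓ ∧ ℓ ≤ ℓ₁ ∧ ∃ σ : ℤ, (σ = 1 ∨ σ = -1) ∧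
      (∀ y : Site 2, |y a - v a| ≤ ℓ → |y (oth a) - v (oth a)| ≤ Wb ℓ →
        y ∈ sBox a 1 c (-(L + R' + ℓ₁)) (L + R' + ℓ₁) (W + R' + WM)) ∧
      ∃ τ : ℤ, (τ = 1 ∨ τ = -1) ∧ ∀ y : Site 2, y a - v a = σ * ℓ → 0 ≤ τ * (y (oth a) - v (oth a)) →
        |y (oth a) - v (oth a)| ≤ Wb ℓ →
          y ∈ sBox a 1 c (-(max (L + R' - ℓ₁) (ℓ₀ : ℤ))) (max (L + R' - ℓ₁) (ℓ₀ : ℤ)) (max (W + R') (WM : ℤ)) := by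
  rw [mem_sBox_iff (Or.inl rfl)] at hv
  obtain ⟨⟨hv1, hv2⟩, hvj⟩ := hv
  have hvo := hvj (oth a) (oth_ne a)
  simp only [one_mul] at hv1 hv2
  set lam : ℤ := v a - c a with hlam
  -- the extent: `ℓ₁` far out, `|λ|` in between, `ℓ₀` near the centre line
  set ℓz : ℤ := max (min |lam| (ℓ₁ : ℤ)) (ℓ₀ : ℤ) with hℓz
  have hℓz0 : 0 ≤ ℓz := le_max_of_le_right (by positivity)
  obtain ⟨ℓ, hℓℓ⟩ : ∃ ℓ : ℕ, (ℓ : ℤ) = ℓz := ⟨_, Int.toNat_of_nonneg hℓz0⟩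
  have hℓlo : (ℓ₀ : ℤ) ≤ ℓ := by rw [hℓℓ]; exact le_max_right _ _
  have hℓhi : (ℓ : ℤ) ≤ ℓ₁ := by
    rw [hℓℓ]; exact max_le ((min_le_right _ _)) (by exact_mod_cast hℓ)
  have hW : ((Wb ℓ : ℕ) : ℤ) ≤ WM := by exact_mod_cast hWM ℓ (by exact_mod_cast hℓhi)
  -- the direction: towards the centre line
  set σ : ℤ := if 0 ≤ lam then -1 else 1 with hσdef
  have hσ : σ = 1 ∨ σ = -1 := by rw [hσdef]; split_ifs <;> simp
  -- the landing level `λ + σ ℓ` has absolute value `≤ max (L + R' − ℓ₁) ℓ₀`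
  have hland : |lam + σ * ℓ| ≤ max (L + R' - ℓ₁) (ℓ₀ : ℤ) := by
    have habs : |lam| ≤ L + R' := abs_le.2 ⟨by linarith, by linarith⟩
    rw [hσdef]
    by_cases h0 : 0 ≤ lam
    · rw [if_pos h0]
      have e : |lam| = lam := abs_of_nonneg h0
      rw [e] at habs
      -- three cases on `lam` vs `ℓ₀`, `ℓ₁`
      rw [abs_le]
      constructor
      · -- `-(max …) ≤ lam - ℓ`
        by_cases h1 : lam ≤ ℓ₁
        · -- `ℓ = max lam ℓ₀ ≥ lam`, and `ℓ - lam ≤ ℓ₀`? if `lam ≥ ℓ₀` then `ℓ = lam`; else `ℓ = ℓ₀`, `ℓ₀ - lam ≤ ℓ₀`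
          have : (ℓ : ℤ) = max lam ℓ₀ := by rw [hℓℓ, hℓz, e, min_eq_left h1]
          rcases le_total lam ℓ₀ with h2 | h2
          · rw [max_eq_right h2] at this
            have := le_max_right (L + R' - ℓ₁) (ℓ₀ : ℤ)
            nlinarith
          · rw [max_eq_left h2] at this
            have := le_max_right (L + R' - ℓ₁) (ℓ₀ : ℤ)
            have h00 : (0:ℤ) ≤ ℓ₀ := by positivity
            nlinarith
        · push Not at h1
          have : (ℓ : ℤ) = ℓ₁ := by
            rw [hℓℓ, hℓz, e, min_eq_right h1.le, max_eq_left (by exact_mod_cast hℓ)]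
          have := le_max_left (L + R' - ℓ₁) (ℓ₀ : ℤ)
          have h00 : (0:ℤ) ≤ ℓ₀ := by positivity
          have := le_max_right (L + R' - ℓ₁) (ℓ₀ : ℤ)
          nlinarith
      · -- `lam - ℓ ≤ max …`
        by_cases h1 : lam ≤ ℓ₁
        · have : (ℓ : ℤ) = max lam ℓ₀ := by rw [hℓℓ, hℓz, e, min_eq_left h1]
          have hge : lam ≤ ℓ := by rw [this]; exact le_max_left _ _
          have := le_max_right (L + R' - ℓ₁) (ℓ₀ : ℤ)
          have h00 : (0:ℤ) ≤ ℓ₀ := by positivity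
          nlinarith
        · push Not at h1
          have : (ℓ : ℤ) = ℓ₁ := by
            rw [hℓℓ, hℓz, e, min_eq_right h1.le, max_eq_left (by exact_mod_cast hℓ)]
          have := le_max_left (L + R' - ℓ₁) (ℓ₀ : ℤ)
          nlinarith
    · rw [if_neg h0]
      push Not at h0
      have e : |lam| = -lam := abs_of_neg h0
      rw [e] at habs
      rw [abs_le, one_mul]
      constructor
      · by_cases h1 : -lam ≤ ℓ₁
        · have : (ℓ : ℤ) = max (-lam) ℓ₀ := by rw [hℓℓ, hℓz, e, min_eq_left h1]
          have hge : -lam ≤ ℓ := by rw [this]; exact le_max_left _ _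
          have := le_max_right (L + R' - ℓ₁) (ℓ₀ : ℤ)
          have h00 : (0:ℤ) ≤ ℓ₀ := by positivity
          nlinarith
        · push Not at h1
          have : (ℓ : ℤ) = ℓ₁ := by
            rw [hℓℓ, hℓz, e, min_eq_right h1.le, max_eq_left (by exact_mod_cast hℓ)]
          have := le_max_left (L + R' - ℓ₁) (ℓ₀ : ℤ)
          nlinarith
      · by_cases h1 : -lam ≤ ℓ₁
        · have : (ℓ : ℤ) = max (-lam) ℓ₀ := by rw [hℓℓ, hℓz, e, min_eq_left h1]
          rcases le_total (-lam) ℓ₀ with h2 | h2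
          · rw [max_eq_right h2] at this
            have := le_max_right (L + R' - ℓ₁) (ℓ₀ : ℤ)
            nlinarith
          · rw [max_eq_left h2] at this
            have := le_max_right (L + R' - ℓ₁) (ℓ₀ : ℤ)
            have h00 : (0:ℤ) ≤ ℓ₀ := by positivity
            nlinarith
        · push Not at h1
          have : (ℓ : ℤ) = ℓ₁ := by
            rw [hℓℓ, hℓz, e, min_eq_right h1.le, max_eq_left (by exact_mod_cast hℓ)]
          have := le_max_left (L + R' - ℓ₁) (ℓ₀ : ℤ)
          have h00 : (0:ℤ) ≤ ℓ₀ := by positivity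
          have := le_max_right (L + R' - ℓ₁) (ℓ₀ : ℤ)
          nlinarith
  have hmaxl : W + R' ≤ max (W + R') (WM : ℤ) := le_max_left _ _
  have hmaxr : (WM : ℤ) ≤ max (W + R') (WM : ℤ) := le_max_right _ _
  refine ⟨ℓ, by exact_mod_cast hℓlo, by exact_mod_cast hℓhi, σ, hσ, fun y hya hyo => ?_, ?_⟩
  · -- the rectangle lies in the region
    rw [mem_sBox_iff (Or.inl rfl)]
    rw [abs_le] at hya hyo
    refine ⟨?_, fun j hj => ?_⟩
    · rw [one_mul]; constructor <;> linarith [hya.1, hya.2]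
    · rw [eq_oth_of_ne hj]
      constructor <;> linarith [hyo.1, hyo.2, hvo.1, hvo.2]
  · -- the half towards the transverse centre line lands in the shrunk core
    refine ⟨if c (oth a) < v (oth a) then -1 else 1, by split_ifs <;> simp, fun y hya hτ hyo => ?_⟩
    rw [mem_sBox_iff (Or.inl rfl)]
    rw [abs_le] at hyo
    refine ⟨?_, fun j hj => ?_⟩
    · have : y a - c a = lam + σ * ℓ := by rw [hlam]; linarith
      rw [one_mul, this]
      exact abs_le.1 hland
    · rw [eq_oth_of_ne hj]
      by_cases hlt : c (oth a) < v (oth a)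
      · rw [if_pos hlt] at hτ
        constructor <;> linarith [hyo.1, hyo.2, hvo.1, hvo.2]
      · rw [if_neg hlt] at hτ
        push Not at hlt
        constructor <;> linarith [hyo.1, hyo.2, hvo.1, hvo.2]

/-! ## §2 The localisation schedule -/

namespace Loc

variable (L₀ W₀ : ℤ) (R' ℓ₀ ℓ₁ WM : ℕ)

/-- The along-width after `i` rounds: `L₀`, then `max (L + R' − ℓ₁) ℓ₀` repeatedly. [this work] -/
def L : ℕ → ℤ
  | 0 => L₀
  | i + 1 => max (L i + R' - ℓ₁) (ℓ₀ : ℤ)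

/-- The transverse width after `i` rounds: `W₀`, then `max (W + R') WM` repeatedly. [this work] -/
def W : ℕ → ℤ
  | 0 => W₀
  | i + 1 => max (W i + R') (WM : ℤ)

/-- `L (i+1)` unfolds. [folklore] -/
@[simp] theorem L_succ (i : ℕ) : L L₀ R' ℓ₀ ℓ₁ (i + 1) = max (L L₀ R' ℓ₀ ℓ₁ i + R' - ℓ₁) (ℓ₀ : ℤ) := rfl

/-- `W (i+1)` unfolds. [folklore] -/
@[simp] theorem W_succ (i : ℕ) : W W₀ R' WM (i + 1) = max (W W₀ R' WM i + R') (WM : ℤ) := rfl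

/-- `L 0 = L₀`. [folklore] -/
@[simp] theorem L_zero : L L₀ R' ℓ₀ ℓ₁ 0 = L₀ := rfl

/-- `W 0 = W₀`. [folklore] -/
@[simp] theorem W_zero : W W₀ R' WM 0 = W₀ := rfl

/-- `ℓ₀ ≤ L i` from round `1` on. [folklore] -/
theorem ℓ₀_le_L_succ (i : ℕ) : (ℓ₀ : ℤ) ≤ L L₀ R' ℓ₀ ℓ₁ (i + 1) := le_max_right _ _

/-- The along-width never exceeds `max L₀ ℓ₀` (it shrinks: `ℓ₁ ≥ R'`). [this work] -/
theorem L_le (hR : R' ≤ ℓ₁) (i : ℕ) : L L₀ R' ℓ₀ ℓ₁ i ≤ max L₀ (ℓ₀ : ℤ) := by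
  induction i with
  | zero => exact le_max_left _ _
  | succ i ih =>
    rw [L_succ]
    refine max_le ?_ (le_max_right _ _)
    have : (R' : ℤ) ≤ ℓ₁ := by exact_mod_cast hR
    linarith

/-- **The along-width shrinks by `ℓ₁ − R'` per round until it reaches `ℓ₀`**: `L i ≤ max (L₀ − i (ℓ₁ − R')) ℓ₀`. [this work] -/
theorem L_le_of_le (hR : R' ≤ ℓ₁) (i : ℕ) : L L₀ R' ℓ₀ ℓ₁ i ≤ max (L₀ - (i : ℤ) * (ℓ₁ - R')) (ℓ₀ : ℤ) := by
  induction i with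
  | zero => simp
  | succ i ih =>
    rw [L_succ]
    refine max_le ?_ (le_max_right _ _)
    have hR' : (R' : ℤ) ≤ ℓ₁ := by exact_mod_cast hR
    rcases le_total (L₀ - (i : ℤ) * (ℓ₁ - R')) (ℓ₀ : ℤ) with h | h
    · rw [max_eq_right h] at ih
      exact le_max_of_le_right (by linarith)
    · rw [max_eq_left h] at ih
      refine le_max_of_le_left ?_
      push_cast
      nlinarith

/-- **After enough rounds the along-width is the least extent**: `L₀ ≤ N (ℓ₁ − R') + ℓ₀` and `1 ≤ N` give `L N = ℓ₀`. [this work] -/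
theorem L_eq_ℓ₀ (hR : R' ≤ ℓ₁) {N : ℕ} (hN1 : 1 ≤ N) (hN : L₀ ≤ (N : ℤ) * (ℓ₁ - R') + ℓ₀) : L L₀ R' ℓ₀ ℓ₁ N = ℓ₀ := by
  refine le_antisymm ?_ ?_
  · refine (L_le_of_le L₀ R' ℓ₀ ℓ₁ hR N).trans (max_le (by linarith) le_rfl)
  · obtain ⟨n, rfl⟩ : ∃ n, N = n + 1 := ⟨N - 1, by omega⟩
    exact ℓ₀_le_L_succ L₀ R' ℓ₀ ℓ₁ n

/-- **The transverse width grows by `R'` per round** once `WM ≤ W₀`: `W i = W₀ + i R'`. [this work] -/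
theorem W_eq (hW₀ : (WM : ℤ) ≤ W₀) (i : ℕ) : W W₀ R' WM i = W₀ + (i : ℤ) * R' := by
  induction i with
  | zero => simp
  | succ i ih =>
    rw [W_succ, ih, max_eq_left]
    · push_cast; ring
    · have : (0 : ℤ) ≤ (i : ℤ) * R' := by positivity
      linarith

/-- `W₀ ≤ W i` and `WM ≤ W (i+1)`. [folklore] -/
theorem W_mono_facts (i : ℕ) : W₀ ≤ W W₀ R' WM i ∧ (WM : ℤ) ≤ W W₀ R' WM (i + 1) := by
  refine ⟨?_, le_max_right _ _⟩
  induction i with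
  | zero => simp
  | succ i ih =>
    rw [W_succ]
    have h0 : (0 : ℤ) ≤ (R' : ℤ) := Int.natCast_nonneg _
    exact le_max_of_le_left (by linarith)

/-- `W i ≤ W N` for `i ≤ N`. [folklore] -/
theorem W_mono {i N : ℕ} (h : i ≤ N) : W W₀ R' WM i ≤ W W₀ R' WM N := by
  induction N with
  | zero => rw [Nat.le_zero.1 h]
  | succ N ih =>
    rcases Nat.lt_or_eq_of_le h with h' | h'
    · have h0 : (0 : ℤ) ≤ (R' : ℤ) := Int.natCast_nonneg _
      refine (ih (Nat.lt_succ_iff.1 h')).trans ?_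
      rw [W_succ]
      exact le_max_of_le_left (by linarith)
    · rw [h']

variable (a : Fin 2) (c : Site 2)

/-- **The core after `i` rounds**: `{|·_a − c_a| ≤ L i, |·_{a'} − c_{a'}| ≤ W i}`. [cite: KozmaNitzan2024, §4 Lemma 12 (pp. 23–25)] -/
def core (i : ℕ) : Finset (Site 2) := sBox a 1 c (-(L L₀ R' ℓ₀ ℓ₁ i)) (L L₀ R' ℓ₀ ℓ₁ i) (W W₀ R' WM i)

/-- **The region of all rounds** (`N` rounds): `{|·_a − c_a| ≤ max L₀ ℓ₀ + R' + ℓ₁, |·_{a'} − c_{a'}| ≤ W N + R' + WM}`.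
[cite: KozmaNitzan2024, §4 Lemma 12 (pp. 23–25)] -/
def region (N : ℕ) : Finset (Site 2) :=
  sBox a 1 c (-(max L₀ (ℓ₀ : ℤ) + R' + ℓ₁)) (max L₀ (ℓ₀ : ℤ) + R' + ℓ₁) (W W₀ R' WM N + R' + WM)

/-- The parameter hypotheses of the localisation schedule. [this work] -/
structure LocOK (L₀ W₀ : ℤ) (R' ℓ₀ ℓ₁ WM : ℕ) (Wb : ℕ → ℕ) : Prop where
  /-- the cores are boxes -/
  hL₀ : 0 ≤ L₀
  /-- the cores are boxes -/
  hW₀ : 0 ≤ W₀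
  /-- the certified extent range is an interval -/
  hℓ : ℓ₀ ≤ ℓ₁
  /-- each round shrinks -/
  hR : R' ≤ ℓ₁
  /-- the band width is bounded on the certified range -/
  hWM : ∀ ℓ : ℕ, ℓ ≤ ℓ₁ → Wb ℓ ≤ WM

variable {a c} in
/-- Monotone enlargement of symmetric signed boxes. [folklore] -/
theorem sBox_symm_mono {α α' w w' : ℤ} (hα : α ≤ α') (hw : w ≤ w') : sBox a 1 c (-α) α w ⊆ sBox a 1 c (-α') α' w' := by
  intro y hy
  rw [mem_sBox_iff (Or.inl rfl)] at hy ⊢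
  obtain ⟨⟨h1, h2⟩, hj⟩ := hy
  refine ⟨⟨by linarith, by linarith⟩, fun j hjj => ?_⟩
  have := hj j hjj
  constructor <;> linarith [this.1, this.2]

variable {L₀ W₀ R' ℓ₀ ℓ₁ WM} {Wb : ℕ → ℕ} (h : LocOK L₀ W₀ R' ℓ₀ ℓ₁ WM Wb) {a c}
include h

/-- **THE ROUTE OF EVERY ROUND**: from every `v` in the `R'`-enlargement of `core i` (`i < N`) a band rectangle inside `region N` whose near half-side
lands in `core (i+1)`, extent in `[ℓ₀, ℓ₁]`, direction and half chosen from `v`. [cite: KozmaNitzan2024, §4 Lemma 12 (pp. 23–25)] -/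
theorem core_route {i N : ℕ} (hi : i + 1 ≤ N) {v : Site 2}
    (hv : v ∈ sBox a 1 c (-(L L₀ R' ℓ₀ ℓ₁ i + R')) (L L₀ R' ℓ₀ ℓ₁ i + R') (W W₀ R' WM i + R')) :
    ∃ ℓ : ℕ, ℓ₀ ≤ ℓ ∧ ℓ ≤ ℓ₁ ∧ ∃ σ : ℤ, (σ = 1 ∨ σ = -1) ∧
      (∀ y : Site 2, |y a - v a| ≤ ℓ → |y (oth a) - v (oth a)| ≤ Wb ℓ → y ∈ region L₀ W₀ R' ℓ₀ ℓ₁ WM a c N) ∧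
      ∃ τ : ℤ, (τ = 1 ∨ τ = -1) ∧ ∀ y : Site 2, y a - v a = σ * ℓ → 0 ≤ τ * (y (oth a) - v (oth a)) →
        |y (oth a) - v (oth a)| ≤ Wb ℓ → y ∈ core L₀ W₀ R' ℓ₀ ℓ₁ WM a c (i + 1) := by
  obtain ⟨ℓ, hℓ0, hℓ1, σ, hσ, hrect, τ, hτ, hhalf⟩ := route_loc c (L := L L₀ R' ℓ₀ ℓ₁ i) (W := W W₀ R' WM i) Wb h.hℓ h.hWM hv
  refine ⟨ℓ, hℓ0, hℓ1, σ, hσ, fun y h1 h2 => ?_, τ, hτ, fun y h1 h2 h3 => ?_⟩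
  · refine sBox_symm_mono ?_ ?_ (hrect y h1 h2)
    · have hL := L_le L₀ R' ℓ₀ ℓ₁ h.hR i
      linarith
    · have hW := W_mono W₀ R' WM (show i ≤ N by omega)
      linarith
  · exact hhalf y h1 h2 h3

/-- The `R'`-enlargement of every core lies in the region. [folklore] -/
theorem enlarge_core_subset_region {i N : ℕ} (hi : i ≤ N) :
    sBox a 1 c (-(L L₀ R' ℓ₀ ℓ₁ i + R')) (L L₀ R' ℓ₀ ℓ₁ i + R') (W W₀ R' WM i + R') ⊆ region L₀ W₀ R' ℓ₀ ℓ₁ WM a c N := by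
  refine sBox_symm_mono ?_ ?_
  · have h1 := L_le L₀ R' ℓ₀ ℓ₁ h.hR i
    have h2 : (0 : ℤ) ≤ (ℓ₁ : ℤ) := Int.natCast_nonneg _
    linarith
  · have h1 := W_mono W₀ R' WM hi
    have h2 : (0 : ℤ) ≤ (WM : ℤ) := Int.natCast_nonneg _
    linarith

/-- Every core lies in the region. [folklore] -/
theorem core_subset_region {i N : ℕ} (hi : i ≤ N) : core L₀ W₀ R' ℓ₀ ℓ₁ WM a c i ⊆ region L₀ W₀ R' ℓ₀ ℓ₁ WM a c N :=
  (sBox_symm_mono (by linarith [Int.natCast_nonneg (R' : ℕ)]) (by linarith [Int.natCast_nonneg (R' : ℕ)])).trans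
    (enlarge_core_subset_region h hi)

/-- The centre lies in every core (cores are nonempty). [folklore] -/
theorem center_mem_core (i : ℕ) : c ∈ core L₀ W₀ R' ℓ₀ ℓ₁ WM a c i := by
  rw [core, mem_sBox_iff (Or.inl rfl)]
  have hL : 0 ≤ L L₀ R' ℓ₀ ℓ₁ i := by
    cases i with
    | zero => simpa using h.hL₀
    | succ i => exact le_trans (by positivity) (ℓ₀_le_L_succ L₀ R' ℓ₀ ℓ₁ i)
  have hW : 0 ≤ W W₀ R' WM i := le_trans h.hW₀ (W_mono_facts W₀ R' WM i).1
  refine ⟨⟨by simp [hL], by simp [hL]⟩, fun j _ => ⟨by linarith, by linarith⟩⟩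

/-- Cores are nonempty. [folklore] -/
theorem core_nonempty (i : ℕ) : (core L₀ W₀ R' ℓ₀ ℓ₁ WM a c i).Nonempty := ⟨c, center_mem_core h i⟩

end Loc

end ChainPlanar

end Transplant

end Summit.CriticalPhenomena.PercolationContinuityZ3.Theorems

end
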